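import Summits.HodgeConjecture.HodgeConjecture.Theses.LinearSystemTorelli
import Literature.AlgebraicGeometry.HodgeTheory.GysinKernelProofs
import Literature.AlgebraicGeometry.HodgeTheory.SupportedHodgeClassesAlgebraic
import Literature.AlgebraicGeometry.HodgeTheory.VanishingCohomologyNontrivialProofs
import Literature.AlgebraicGeometry.Motives.ComplexPointsOrientation
import Literature.AlgebraicTopology.SingularHomology.GysinTransposition

/-!
# Crux `TranscendentalOrSupported` (stmt-HodgeConjecture-10853), line `Sketch` — REMARKS (lead c1):
# the residue `stub_phantomIrreducible` is NECESSARY, and its CONSTRUCTION FORM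

Companion of `Lines/Sketch.lean` (skeleton v4, isotypic split), kept out of the skeleton so that
`TranscendentalOrSupported_of` stays its only theorem concluding the crux. Two remarks on the one
mathematical stub left, `stub_phantomIrreducible` ("every irreducible rationally spanned sub-Hodge
structure `W ⊆ H²ᵖ(X(ℂ); ℂ)` of rank `≥ 2` without `(2p,0)`-part of a smooth projective `2p`-fold, `p ≥ 2`,
contains a non-zero class supported on a divisor"):

* `phantomIrreducible_of_transcendentalOrSupported` — the crux IMPLIES the residue (apply the crux to
  the rational spanning family `b` of `W`: `W ≤ N¹`, and `W ≠ ⊥`). With the skeleton (residue + the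
  three classical facts + item `MiddleDivisorSupport` ⟹ crux) this certifies that the residue is
  EXACTLY the crux minus its Hodge-conjecture part, modulo Lefschetz (1,1), Deligne 8.2.8 and
  Hodge–Riemann polarizability — the justification of the lead's `promote-stub`.
* `phantomIrreducible_of_oneGysinClass` — the CONSTRUCTION FORM of the residue (Voisin, J. Open Math.
  Probl. 1 (2025) §4.3, "the generalized Hodge conjecture as a construction problem", display (32),
  weakened from `L ⊂ Im j_*` to ONE non-zero class thanks to the bootstrap): to settle the residue for
  a phantom constituent `W` it suffices to exhibit ONE morphism `g : Y ⟶ X` from a smooth projective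
  `Y` of dimension `m < 2p` and ONE class `y ∈ Hᵃ(Y(ℂ); ℂ)` whose Gysin image `g_* y` is a non-zero
  element of `W` — Gysin images from lower-dimensional varieties are supported on the proper closed
  image (`complexGysin_mem_supportedClasses`, the tree's theorem; Poincaré duality from
  `OrientationFamily.hasPoincareDuality`). In the route's dictionary: one tube/vanishing-cycle class of
  the linear system with non-zero component along `W`.
-/

noncomputable section

set_option linter.dupNamespace false

open CategoryTheory
open Literature.AlgebraicGeometry.Motives Literature.AlgebraicGeometry.HodgeTheory
open Literature.AlgebraicTopology.SingularHomology

namespace Summit.HodgeConjecture.HodgeConjecture.Cruxes.TranscendentalOrSupported.IsotypicBootstrap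

variable {p : ℕ} {X : SchemeOver ℂ}

/-- **The crux implies the residue.** Under `TranscendentalOrSupported`, every rationally spanned
sub-Hodge span `W = span b` (read in `A`) without `(2p,0)`-part lies in `N¹ H²ᵖ`; if moreover
`dim W ≥ 2` then `W ≠ ⊥`, so `W ⊓ N¹ = W ≠ ⊥`. (Irreducibility is not even needed.) -/
theorem phantomIrreducible_of_transcendentalOrSupported
    (hT : Summit.HodgeConjecture.HodgeConjecture.Theses.LinearSystemTorelli.TranscendentalOrSupported)
    (h2 : 2 ≤ p) (hX : IsSmoothProjective (2 * p) X) (A : HodgeModel (2 * p) X) (r : ℕ)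
    (b : Fin r → complexBetti X (2 * p)) (hb : ∀ j, IsRationalClass (b j))
    (hsub : (Submodule.span ℂ (Set.range b)).map (A.pullback (2 * p)).hom =
      ⨆ (p' : ℕ) (q' : ℕ) (_ : p' + q' = 2 * p),
        (Submodule.span ℂ (Set.range b)).map (A.pullback (2 * p)).hom ⊓ A.hodgePQ (2 * p) p' q')
    (hbot : (Submodule.span ℂ (Set.range b)).map (A.pullback (2 * p)).hom ⊓
      A.hodgePQ (2 * p) (2 * p) 0 = ⊥)
    (hrk : 2 ≤ Module.finrank ℂ (Submodule.span ℂ (Set.range b))) :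
    Submodule.span ℂ (Set.range b) ⊓ supportedClasses X (2 * p) 1 ≠ ⊥ := by
  have hle : Submodule.span ℂ (Set.range b) ≤ supportedClasses X (2 * p) 1 := by
    rw [Submodule.span_le]
    rintro _ ⟨j, rfl⟩
    exact hT (by omega) hX A r b hb hsub hbot j
  rw [inf_eq_left.2 hle]
  intro h
  rw [h, finrank_bot] at hrk
  omega

/-- **Construction form of the residue**: if some Gysin image `g_* y ∈ H²ᵖ(X(ℂ); ℂ)` from a smooth
projective `Y` of dimension `m < 2p` (`g : Y ⟶ X`, `y ∈ Hᵃ(Y(ℂ); ℂ)`, `a + 4p = 2p + 2m`, any orientation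
family `μ`) is a NON-ZERO element of `W`, then `W ⊓ N¹ H²ᵖ ≠ ⊥` — `g_* y` dies off the proper closed
subset `g(Y)` (`complexGysin_mem_supportedClasses` with `r = 0`, `s = 1`, fed with the theorem
`gysinMap_restrictCompl_eq_zero_of_field ℂ` and Poincaré duality `OrientationFamily.hasPoincareDuality`). -/
theorem phantomIrreducible_of_oneGysinClass (μ : OrientationFamily) (hX : IsSmoothProjective (2 * p) X)
    (W : Submodule ℂ (complexBetti X (2 * p))) {m : ℕ} {Y : SchemeOver ℂ}
    (hY : IsSmoothProjective m Y) (hm : m < 2 * p) (g : Y ⟶ X) {a : ℕ}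
    (hab : a + 2 * (2 * p) = 2 * p + 2 * m) (y : complexBetti Y a)
    (hyW : complexGysin μ hY hX g hab y ∈ W) (hy0 : complexGysin μ hY hX g hab y ≠ 0) :
    W ⊓ supportedClasses X (2 * p) 1 ≠ ⊥ := by
  have hN : complexGysin μ hY hX g hab y ∈ supportedClasses X (2 * p) 1 :=
    complexGysin_mem_supportedClasses (gysinMap_restrictCompl_eq_zero_of_field ℂ) μ
      μ.hasPoincareDuality hY hX g hab (r := 0) (s := 1) (by omega)
      (by rw [supportedClasses_zero]; exact Submodule.mem_top)
  intro h
  exact hy0 ((Submodule.eq_bot_iff _).1 h _ ⟨hyW, hN⟩)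

end Summit.HodgeConjecture.HodgeConjecture.Cruxes.TranscendentalOrSupported.IsotypicBootstrap

end
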